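import Summits.Ventures.YMGap.RobustBall.UniformMassGapZdG
import Summits.Ventures.YMGap.RobustBall.LocalSourceScreening
import HarnessLib

/-!
# Venture YMGap, track ROBUST-BALL (Y2) — the WINDOW TILT DEFECT: the kernels of `W + V` and `W` on a window differ, on
# Lipschitz observables, by at most (window load of the source) × (oscillation of the observable over the fibre)

HONEST FRAMING. WHAT THIS IS: a venture file (cell `pub-ymgap`, track Y2 ROBUST-BALL, seat rb-p1, theorems only). The files
`LocalSourceScreeningStar[Geometric].lean` screen a local source of ANY strength with a strength-free constant (`2√N`), by declaring the
stars that read the source UNUSABLE. This file keeps those stars usable WITH A DEFECT: on a star `⋆` the kernels of `W` and `W + V` are a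
tilt of one another by the source energy `H^V_⋆`, whose oscillation over the star's fibre is at most the WINDOW LOAD
`B_⋆ = Σ_{x ∈ ⋆} Σ_{A listed at ⋆, x ∈ A} osc_A(x)`, so that (`abs_integral_sub_integral_tilted_le`, a Grüss-type bound)

  `|γ^W_⋆ G(σ) − γ^{W+V}_⋆ G(σ)| ≤ min(e^{B_⋆} − 1, 2) · R · Σ_{x ∈ ⋆} δ_x(G)`   (`window_defect_le`),

the input of the Literature's window comparison WITH DEFECTS (`DobrushinShlosman.abs_integral_sub_integral_le_of_window_pair_defect`);
the consumer `LocalSourceScreeningStarDefect.lean` turns it into LINEAR RESPONSE through the star door. Contents: the Grüss-type tilt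
bound `abs_integral_sub_integral_tilted_le` (any probability measure carried by a set on which the exponent oscillates by `≤ B` and the
observable by `≤ ω`: the tilted and untilted means differ by `≤ ω · min(e^B − 1, 2)`), the identity `perturbedYM_add_eq_tilted`
(the kernel of `W + V` is the kernel of `W` tilted by `−H^V_Δ`), the WINDOW LOAD `windowLoad suppV oscV Δ` (a definition) and
`window_defect_le`. WHAT THIS IS NOT: no door, no rate; lattice bookkeeping only, nothing about the continuum limit or a Clay-sense mass gap.
-/

noncomputable section

open MeasureTheory ProbabilityTheory Function Finset Real
open scoped NNReal
open Literature.Probability.LatticeModels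
open Literature.Probability.LatticeModels.DobrushinMetric (IsLipBound integrable_of_abs_le' abs_sub_le_mul_sum_of_dependsOn)
open Literature.MathematicalPhysics.QuantumLattice
open Literature.MathematicalPhysics.QuantumFieldTheory hiding ZdEdge Site
open Summit.Ventures.YMGap.DSWindowZd

namespace Summit.Ventures.YMGap.RobustBall

variable {d N : ℕ}

/-! ## §0 A Grüss-type bound for a tilt with small oscillation on the support -/

section Tilt

variable {α : Type*} [MeasurableSpace α]

/-- **Tilting by an exponent of small oscillation moves bounded observables little.** `μ` a probability measure carried by `T`
(`μ`-a.e. point lies in `T`), `h, g` bounded measurable, with `|h a − h b| ≤ B` and `|g a − g b| ≤ ω` for `a, b ∈ T`. Then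
`|∫ g d(μ.tilted(−h)) − ∫ g dμ| ≤ ω · min(e^{B} − 1, 2)`: the tilt density `e^{−h}/μ(e^{−h})` lies in `[e^{−B}, e^{B}]` on `T`, and the
difference is `∫ (ρ − 1)(g − g(a₀)) dμ`. -/
theorem abs_integral_sub_integral_tilted_le (μ : Measure α) [IsProbabilityMeasure μ] {T : Set α}
    (hT : ∀ᵐ a ∂μ, a ∈ T) {h g : α → ℝ} (hhm : Measurable h) (hgm : Measurable g) {Ch Cg : ℝ}
    (hhb : ∀ a, |h a| ≤ Ch) (hgb : ∀ a, |g a| ≤ Cg) {B ω : ℝ} (hB : ∀ a ∈ T, ∀ b ∈ T, |h a - h b| ≤ B)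
    (hω : ∀ a ∈ T, ∀ b ∈ T, |g a - g b| ≤ ω) :
    |∫ a, g a ∂(μ.tilted fun a => -h a) - ∫ a, g a ∂μ| ≤ ω * min (Real.exp B - 1) 2 := by
  -- a point of `T`
  obtain ⟨a₀, ha₀⟩ : ∃ a₀, a₀ ∈ T := hT.exists
  have hB0 : 0 ≤ B := by simpa using hB a₀ ha₀ a₀ ha₀
  have hω0 : 0 ≤ ω := by simpa using hω a₀ ha₀ a₀ ha₀
  -- bounded measurable functions are integrable
  have hint : ∀ {f : α → ℝ}, Measurable f → ∀ {C : ℝ}, (∀ a, |f a| ≤ C) → Integrable f μ := fun hf C hC =>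
    Integrable.of_bound hf.aestronglyMeasurable C (ae_of_all _ fun a => by rw [Real.norm_eq_abs]; exact hC a)
  -- the normaliser
  set Z : ℝ := ∫ a, Real.exp (-h a) ∂μ with hZ
  have hem : Measurable fun a => Real.exp (-h a) := hhm.neg.exp
  have heb : ∀ a, |Real.exp (-h a)| ≤ Real.exp Ch := fun a => by
    rw [abs_of_pos (Real.exp_pos _)]
    exact Real.exp_le_exp.2 (by linarith [(abs_le.1 (hhb a)).1])
  have hei : Integrable (fun a => Real.exp (-h a)) μ := hint hem heb
  have hZpos : 0 < Z := by
    rw [hZ]; exact integral_exp_pos hei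
  -- the density `ρ = e^{-h}/Z` and its bounds on `T`
  set ρ : α → ℝ := fun a => Real.exp (-h a) / Z with hρ
  have hρT : ∀ a ∈ T, |ρ a - 1| ≤ Real.exp B - 1 := by
    intro a ha
    -- `e^{-B} e^{-h a} ≤ Z ≤ e^{B} e^{-h a}`
    have hup : Z ≤ Real.exp B * Real.exp (-h a) := by
      have h1 : ∫ b, Real.exp (-h b) ∂μ ≤ ∫ _b, Real.exp B * Real.exp (-h a) ∂μ := by
        refine integral_mono_ae hei (integrable_const _) ?_
        filter_upwards [hT] with b hb
        rw [← Real.exp_add]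
        exact Real.exp_le_exp.2 (by linarith [(abs_le.1 (hB a ha b hb)).1, (abs_le.1 (hB a ha b hb)).2])
      simpa using h1
    have hlo : Real.exp (-B) * Real.exp (-h a) ≤ Z := by
      have h1 : ∫ _b, Real.exp (-B) * Real.exp (-h a) ∂μ ≤ ∫ b, Real.exp (-h b) ∂μ := by
        refine integral_mono_ae (integrable_const _) hei ?_
        filter_upwards [hT] with b hb
        rw [← Real.exp_add]
        exact Real.exp_le_exp.2 (by linarith [(abs_le.1 (hB a ha b hb)).1, (abs_le.1 (hB a ha b hb)).2])
      simpa using h1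
    have hea : 0 < Real.exp (-h a) := Real.exp_pos _
    have hρle : ρ a ≤ Real.exp B := by
      simp only [hρ]
      rw [div_le_iff₀ hZpos]
      calc Real.exp (-h a) = Real.exp B * (Real.exp (-B) * Real.exp (-h a)) := by
            rw [← mul_assoc, ← Real.exp_add]; simp
        _ ≤ Real.exp B * Z := mul_le_mul_of_nonneg_left hlo (Real.exp_pos _).le
    have hρge : Real.exp (-B) ≤ ρ a := by
      simp only [hρ]
      rw [le_div_iff₀ hZpos]
      calc Real.exp (-B) * Z ≤ Real.exp (-B) * (Real.exp B * Real.exp (-h a)) :=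
            mul_le_mul_of_nonneg_left hup (Real.exp_pos _).le
        _ = Real.exp (-h a) := by rw [← mul_assoc, ← Real.exp_add]; simp
    have h3 : 1 - Real.exp (-B) ≤ Real.exp B - 1 := by
      have h4 : Real.exp (-B) * Real.exp B = 1 := by rw [← Real.exp_add]; simp
      nlinarith [Real.exp_pos (-B), Real.exp_pos B, Real.add_one_le_exp B]
    rw [abs_le]; constructor <;> linarith
  -- `∫ ρ dμ = 1`, so `∫ g dμ^{-h} − ∫ g dμ = ∫ (ρ − 1)(g − g a₀) dμ`
  have hρm : Measurable ρ := hem.div_const _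
  have hρb : ∀ a, |ρ a| ≤ Real.exp Ch / Z := fun a => by
    simp only [hρ]; rw [abs_div, abs_of_pos hZpos]; exact div_le_div_of_nonneg_right (heb a) hZpos.le
  have hρi : Integrable ρ μ := hint hρm hρb
  have hgi : Integrable g μ := hint hgm hgb
  have hρgi : Integrable (fun a => ρ a * g a) μ :=
    hρi.mul_bdd hgm.aestronglyMeasurable (ae_of_all _ fun a => by rw [Real.norm_eq_abs]; exact hgb a)
  have hρ1 : ∫ a, ρ a ∂μ = 1 := by
    simp only [hρ]
    rw [integral_div, div_self hZpos.ne']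
  have htilt : ∫ a, g a ∂(μ.tilted fun a => -h a) = ∫ a, ρ a * g a ∂μ := by
    rw [integral_tilted]
    rfl
  have hident : (∫ a, g a ∂(μ.tilted fun a => -h a)) - ∫ a, g a ∂μ = ∫ a, (ρ a - 1) * (g a - g a₀) ∂μ := by
    rw [htilt]
    have h1 : ∫ a, (ρ a - 1) * (g a - g a₀) ∂μ =
        ∫ a, (ρ a * g a - g a - (g a₀) * ρ a + g a₀) ∂μ := integral_congr_ae (ae_of_all _ fun a => by ring)
    rw [h1, integral_add, integral_sub, integral_sub hρgi hgi, integral_const_mul, hρ1, integral_const]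
    · simp
    · exact hρgi.sub hgi
    · exact hρi.const_mul _
    · exact (hρgi.sub hgi).sub (hρi.const_mul _)
    · exact integrable_const _
  rw [hident]
  have hprod : Integrable (fun a => (ρ a - 1) * (g a - g a₀)) μ :=
    (hρi.sub (integrable_const _)).mul_bdd (hgm.sub measurable_const).aestronglyMeasurable
      (ae_of_all _ fun a => by
        rw [Real.norm_eq_abs]
        exact (abs_sub _ _).trans (add_le_add (hgb a) (hgb a₀)))
  -- the two bounds
  rcases le_total (Real.exp B - 1) 2 with hcase | hcase
  · rw [min_eq_left hcase]
    calc |∫ a, (ρ a - 1) * (g a - g a₀) ∂μ| ≤ ∫ a, |(ρ a - 1) * (g a - g a₀)| ∂μ := abs_integral_le_integral_abs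
      _ ≤ ∫ _a, (Real.exp B - 1) * ω ∂μ := by
          refine integral_mono_ae hprod.abs (integrable_const _) ?_
          filter_upwards [hT] with a ha
          rw [abs_mul]
          exact mul_le_mul (hρT a ha) (hω a ha a₀ ha₀) (abs_nonneg _) (by linarith [Real.add_one_le_exp B])
      _ = ω * (Real.exp B - 1) := by simp [mul_comm]
  · rw [min_eq_right hcase]
    have hρ0 : ∀ a, 0 ≤ ρ a := fun a => div_nonneg (Real.exp_pos _).le hZpos.le
    calc |∫ a, (ρ a - 1) * (g a - g a₀) ∂μ| ≤ ∫ a, |(ρ a - 1) * (g a - g a₀)| ∂μ := abs_integral_le_integral_abs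
      _ ≤ ∫ a, (ρ a + 1) * ω ∂μ := by
          refine integral_mono_ae hprod.abs ((hρi.add (integrable_const _)).mul_const _) ?_
          filter_upwards [hT] with a ha
          rw [abs_mul]
          refine mul_le_mul ?_ (hω a ha a₀ ha₀) (abs_nonneg _) (by linarith [hρ0 a])
          rw [abs_le]; constructor <;> linarith [hρ0 a]
      _ = ω * 2 := by
          rw [integral_mul_const, integral_add hρi (integrable_const _), hρ1, integral_const]
          simp; ring

end Tilt

/-! ## §1 The kernels of `W + V` are a tilt of the kernels of `W`; the window defect -/

section WindowDefect

variable {G : Type*} [Group G] [TopologicalSpace G] [IsTopologicalGroup G] [CompactSpace G]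
  [MeasurableSpace G] [BorelSpace G] [SecondCountableTopology G] (ρ : G →* Matrix (Fin N) (Fin N) ℂ)

/-- **The kernel of `W + V` in `Δ` is the kernel of `W` tilted by `−H^V_Δ`** (the two energies differ by the source Hamiltonian;
`Measure.tilted_tilted`). -/
theorem perturbedYM_add_eq_tilted (hρ : Continuous ρ) (β : ℝ) {W V : Potential (ZdEdge d) G}
    {supp suppV : Finset (ZdEdge d) → Finset (Finset (ZdEdge d))} (hsupp : W.IsSupportedBy supp)
    (hsuppV : V.IsSupportedBy suppV) (hWm : ∀ X, Measurable (W X)) (hWb : ∀ X, ∃ C, ∀ U, |W X U| ≤ C)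
    (Δ : Finset (ZdEdge d)) (η : LGConfig d G) :
    perturbedYM ρ β (W + V) (fun Λ => supp Λ ∪ suppV Λ) Δ η =
      (perturbedYM ρ β W supp Δ η).tilted fun U => -hamiltonianIn V suppV Δ U := by
  classical
  have hE : perturbedEnergy ρ β (W + V) (fun Λ => supp Λ ∪ suppV Λ) Δ =
      perturbedEnergy ρ β W supp Δ + fun U => -hamiltonianIn V suppV Δ U := by
    funext U
    simp only [perturbedEnergy, Pi.add_apply]
    rw [hamiltonianIn_add_apply, hamiltonianIn_eq_of_subfamily hsupp (fun Λ => Finset.subset_union_left) Δ,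
      hamiltonianIn_eq_of_subfamily hsuppV (supp' := fun Λ => supp Λ ∪ suppV Λ)
        (fun Λ => Finset.subset_union_right) Δ]
    ring
  unfold perturbedYM
  rw [hE]
  haveI : IsProbabilityMeasure ((Measure.pi fun _ : ↥Δ => haarProbability G).map (glueWith Δ · η)) :=
    Measure.isProbabilityMeasure_map (measurable_glueWith Δ η).aemeasurable
  obtain ⟨C, hC⟩ := exists_abs_perturbedEnergy_le ρ hρ β hWb supp Δ
  have hint : Integrable (fun U => Real.exp (perturbedEnergy ρ β W supp Δ U))
      ((Measure.pi fun _ : ↥Δ => haarProbability G).map (glueWith Δ · η)) :=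
    Integrable.of_bound ((measurable_perturbedEnergy ρ hρ β hWm supp Δ).exp).aestronglyMeasurable (Real.exp C)
      (ae_of_all _ fun U => by
        rw [Real.norm_eq_abs, abs_of_pos (Real.exp_pos _)]
        exact Real.exp_le_exp.2 (abs_le.1 (hC U)).2)
  exact (tilted_tilted hint _).symm

end WindowDefect

/-- Oscillation witnesses add up over finite sums (local copy of `TermPerturbation.isOscBound_sum`). -/
private theorem isOscBound_finset_sum {ι V S : Type*} (s : Finset ι) {f : ι → (V → S) → ℝ} {δ : ι → V → ℝ}
    (h : ∀ i ∈ s, Dobrushin.IsOscBound (f i) (δ i)) :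
    Dobrushin.IsOscBound (fun σ => ∑ i ∈ s, f i σ) fun y => ∑ i ∈ s, δ i y := by
  refine ⟨fun y => Finset.sum_nonneg fun i hi => (h i hi).nonneg y, fun y σ τ hστ => ?_⟩
  rw [← Finset.sum_sub_distrib]
  exact (Finset.abs_sum_le_sum_abs _ _).trans (Finset.sum_le_sum fun i hi => (h i hi).le y σ τ hστ)

variable (d) in
/-- **The window load** of the source `(V, suppV)` with oscillation witnesses `oscV` on the finite link set `Δ`:
`B_Δ = Σ_{x ∈ Δ} Σ_{A ∈ suppV Δ, A ∩ Δ ≠ ∅} oscV A x` — a bound for the oscillation of `H^V_Δ` over the fibre of `Δ`. -/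
def windowLoad (suppV : Finset (ZdEdge d) → Finset (Finset (ZdEdge d))) (oscV : Finset (ZdEdge d) → ZdEdge d → ℝ)
    (Δ : Finset (ZdEdge d)) : ℝ :=
  ∑ x ∈ Δ, ∑ A ∈ (suppV Δ).filter (fun A => (A ∩ Δ).Nonempty), oscV A x

/-- **THE WINDOW DEFECT** between the kernels of `W` and `W + V` in a finite volume `Δ`, same boundary condition: for a bounded
measurable `g` with Frobenius-Lipschitz vector `δ`,
`|∫ g dγ^W_Δ(σ) − ∫ g dγ^{W+V}_Δ(σ)| ≤ (2√N Σ_{x ∈ Δ} δ x) · min(e^{B_Δ} − 1, 2)`, `B_Δ` the window load — linear in the source. -/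
theorem window_defect_le (β : ℝ) {W V : Potential (ZdEdge d) (SUN N)}
    (hW : W.IsAdapted) (hWb : ∀ X, ∃ C, ∀ U, |W X U| ≤ C) (hV : V.IsAdapted) (hVb : ∀ X, ∃ C, ∀ U, |V X U| ≤ C)
    {supp suppV : Finset (ZdEdge d) → Finset (Finset (ZdEdge d))} (hsupp : W.IsSupportedBy supp)
    (hsuppV : V.IsSupportedBy suppV) {oscV : Finset (ZdEdge d) → ZdEdge d → ℝ}
    (hoscV : ∀ X, Dobrushin.IsOscBound (V X) (oscV X)) (Δ : Finset (ZdEdge d)) (σ : LGConfig d (SUN N))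
    {g : LGConfig d (SUN N) → ℝ} (hgm : Measurable g) {Bg : ℝ} (hgb : ∀ τ, |g τ| ≤ Bg) {δ : ZdEdge d → ℝ}
    (hδ : IsLipBound suFrobDist g δ) :
    |∫ τ, g τ ∂(perturbedYM (d := d) (fundamentalRep (Fin N)) β W supp Δ σ) -
        ∫ τ, g τ ∂(perturbedYM (d := d) (fundamentalRep (Fin N)) β (W + V) (fun Λ => supp Λ ∪ suppV Λ) Δ σ)| ≤
      (2 * Real.sqrt N * ∑ x ∈ Δ, δ x) * min (Real.exp (windowLoad d suppV oscV Δ) - 1) 2 := by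
  classical
  haveI : SecondCountableTopology (Matrix (Fin N) (Fin N) ℂ) :=
    inferInstanceAs (SecondCountableTopology (Fin N → Fin N → ℂ))
  haveI : SecondCountableTopology (SUN N) := Topology.IsEmbedding.subtypeVal.secondCountableTopology
  have hWm : ∀ X, Measurable (W X) := fun X => (hW X).2
  have hVm : ∀ X, Measurable (V X) := fun X => (hV X).2
  have hγ : IsSpecification (perturbedYM (d := d) (fundamentalRep (Fin N)) β W supp) :=
    isSpecification_perturbedYM _ (continuous_fundamentalRep (Fin N)) _ hW hWb hsupp
  set P := perturbedYM (d := d) (fundamentalRep (Fin N)) β W supp Δ σ with hP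
  haveI : IsProbabilityMeasure P := hγ.isProbability Δ σ
  rw [perturbedYM_add_eq_tilted (fundamentalRep (Fin N)) (continuous_fundamentalRep (Fin N)) β hsupp hsuppV hWm hWb Δ σ,
    abs_sub_comm]
  -- the source Hamiltonian: measurable, bounded, oscillation `≤ B_Δ` over the fibre
  set HV : LGConfig d (SUN N) → ℝ := fun U => hamiltonianIn V suppV Δ U with hHV
  choose CV hCV using hVb
  have hHVm : Measurable HV := measurable_hamiltonianIn hVm suppV Δ
  have hHVb : ∀ U, |HV U| ≤ ∑ A ∈ (suppV Δ).filter (fun A => (A ∩ Δ).Nonempty), CV A := fun U =>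
    abs_hamiltonianIn_le (fun A U => hCV A U) suppV Δ U
  -- the fibre of `Δ` carries the kernel
  have hT : ∀ᵐ τ ∂P, τ ∈ {τ : LGConfig d (SUN N) | ∀ e ∉ Δ, τ e = σ e} := hγ.proper Δ σ
  -- oscillation of `HV` over the fibre, via `HV ∘ piecewise`
  set w : ZdEdge d → ℝ := fun x => ∑ A ∈ (suppV Δ).filter (fun A => (A ∩ Δ).Nonempty), oscV A x with hw
  have hoscHV : Dobrushin.IsOscBound HV w := by
    have := isOscBound_finset_sum ((suppV Δ).filter (fun A => (A ∩ Δ).Nonempty)) (f := fun A => V A)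
      (δ := fun A => oscV A) fun A _ => hoscV A
    simpa only [hHV, hw, hamiltonianIn] using this
  have hpw : ∀ τ : LGConfig d (SUN N), (∀ e ∉ Δ, τ e = σ e) → Δ.piecewise τ σ = τ := fun τ hτ => by
    funext e
    by_cases he : e ∈ Δ
    · rw [Finset.piecewise_eq_of_mem _ _ _ he]
    · rw [Finset.piecewise_eq_of_notMem _ _ _ he, hτ e he]
  have hB : ∀ a ∈ {τ : LGConfig d (SUN N) | ∀ e ∉ Δ, τ e = σ e}, ∀ b ∈ {τ : LGConfig d (SUN N) | ∀ e ∉ Δ, τ e = σ e},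
      |HV a - HV b| ≤ windowLoad d suppV oscV Δ := by
    intro a ha b hb
    set f : LGConfig d (SUN N) → ℝ := fun U => HV (Δ.piecewise U σ) with hf
    have hfdep : DependsOn f (↑Δ : Set (ZdEdge d)) := fun U U' h => by
      simp only [hf]
      congr 1
      funext e
      by_cases he : e ∈ Δ
      · rw [Finset.piecewise_eq_of_mem _ _ _ he, Finset.piecewise_eq_of_mem _ _ _ he, h e (Finset.mem_coe.2 he)]
      · rw [Finset.piecewise_eq_of_notMem _ _ _ he, Finset.piecewise_eq_of_notMem _ _ _ he]
    have hfosc : Dobrushin.IsOscBound f w := by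
      refine ⟨hoscHV.nonneg, fun y U U' hUU' => hoscHV.le y _ _ fun v hv => ?_⟩
      by_cases hvΔ : v ∈ Δ
      · rw [Finset.piecewise_eq_of_mem _ _ _ hvΔ, Finset.piecewise_eq_of_mem _ _ _ hvΔ, hUU' v hv]
      · rw [Finset.piecewise_eq_of_notMem _ _ _ hvΔ, Finset.piecewise_eq_of_notMem _ _ _ hvΔ]
    have key := Dobrushin.abs_sub_le_sum_of_dependsOn hfdep hfosc a b
    simp only [hf, hpw a ha, hpw b hb] at key
    simpa only [windowLoad, hw] using key
  -- oscillation of `g` over the fibre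
  have hω : ∀ a ∈ {τ : LGConfig d (SUN N) | ∀ e ∉ Δ, τ e = σ e}, ∀ b ∈ {τ : LGConfig d (SUN N) | ∀ e ∉ Δ, τ e = σ e},
      |g a - g b| ≤ 2 * Real.sqrt N * ∑ x ∈ Δ, δ x := by
    intro a ha b hb
    set f : LGConfig d (SUN N) → ℝ := fun U => g (Δ.piecewise U σ) with hf
    have hfdep : DependsOn f (↑Δ : Set (ZdEdge d)) := fun U U' h => by
      simp only [hf]
      congr 1
      funext e
      by_cases he : e ∈ Δ
      · rw [Finset.piecewise_eq_of_mem _ _ _ he, Finset.piecewise_eq_of_mem _ _ _ he, h e (Finset.mem_coe.2 he)]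
      · rw [Finset.piecewise_eq_of_notMem _ _ _ he, Finset.piecewise_eq_of_notMem _ _ _ he]
    have hflip : IsLipBound suFrobDist f δ := by
      refine ⟨hδ.nonneg, fun y U U' hUU' => ?_⟩
      by_cases hyΔ : y ∈ Δ
      · have h1 := hδ.le y (Δ.piecewise U σ) (Δ.piecewise U' σ) fun v hv => by
          by_cases hvΔ : v ∈ Δ
          · rw [Finset.piecewise_eq_of_mem _ _ _ hvΔ, Finset.piecewise_eq_of_mem _ _ _ hvΔ, hUU' v hv]
          · rw [Finset.piecewise_eq_of_notMem _ _ _ hvΔ, Finset.piecewise_eq_of_notMem _ _ _ hvΔ]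
        rw [Finset.piecewise_eq_of_mem _ _ _ hyΔ, Finset.piecewise_eq_of_mem _ _ _ hyΔ] at h1
        exact h1
      · have : Δ.piecewise U σ = Δ.piecewise U' σ := by
          funext v
          by_cases hvΔ : v ∈ Δ
          · rw [Finset.piecewise_eq_of_mem _ _ _ hvΔ, Finset.piecewise_eq_of_mem _ _ _ hvΔ,
              hUU' v (fun h => hyΔ (h ▸ hvΔ))]
          · rw [Finset.piecewise_eq_of_notMem _ _ _ hvΔ, Finset.piecewise_eq_of_notMem _ _ _ hvΔ]
        simp only [hf, this, sub_self, abs_zero]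
        exact mul_nonneg (hδ.nonneg y) (suFrobDist_nonneg _ _)
    have key := abs_sub_le_mul_sum_of_dependsOn suFrobDist_le hfdep hflip a b
    simp only [hf, hpw a ha, hpw b hb] at key
    exact key
  exact abs_integral_sub_integral_tilted_le P hT hHVm hgm hHVb hgb hB hω

end Summit.Ventures.YMGap.RobustBall

end
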